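import Literature.NumberTheory.Automorphic.UnitaryGroupArchLatticeJunction
import Literature.AlgebraicGeometry.ShimuraVarieties.UnitaryBallRationalImage
import HarnessLib

/-!
# The archimedean section of `U(J)(𝔸_F)` at one infinite place

Registry: pub-hodgecm MODEL-CONSTRUCTION sub-cell, period lane (node «S-arch»: the honest archimedean side
`ιinf` / `Gfin` / `comm_fin` / `rat_split` of the theta-side datum). Proved lemmas (kernel) plus transparent
definitions; no named facts, no proof placeholders; imports = Mathlib + tree.

For the unitary group `U(J)` of a CM-type pair `(F, E, c)` with `c ≠ 1` fixing every infinite place of `E`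
(`UnitaryGroupArchimedeanPlaces`, § 3: `archPiEquiv : U(J)(E ⊗ ℝ) ≃ₜ* Π_w U(σ_w J)(ℂ)`) and the product
decomposition `U(J)(𝔸_F) = U(J)(E ⊗ ℝ) · U(J)(𝔸_{F,f})` (`UnitaryGroupAdelicProduct`: `archPart`, `finPart`,
`archToAdelic`, `finAdelicToAdelic`), this file supplies the converse of the local PROJECTIONS `archAt w`,
`archAtEmb τ`, `archProjU21Emb τ T` of the automorphic lane, namely the local SECTIONS:

* § 1 (generic, one complex place `w₁`): `archSingle w₁ : U(σ_{w₁} J)(ℂ) →* U(J)(E ⊗ ℝ)`, `u ↦ (u at w₁, 1 elsewhere)`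
  (`archPiEquiv.symm ∘ Pi.mulSingle w₁`; `archAt w₁ ∘ archSingle w₁ = id`, `archAt w ∘ archSingle w₁ = 1` for
  `w ≠ w₁`), `adelicSingle w₁ = archToAdelic ∘ archSingle w₁ : U(σ_{w₁} J)(ℂ) →* U(J)(𝔸_F)`, and the subgroup
  `awayFrom w₁ = ker (archAt w₁ ∘ archPart) ≤ U(J)(𝔸_F)` of elements with trivial `w₁`-component
  (`= Π_{w ≠ w₁} U(σ_w J)(ℂ) × U(J)(𝔸_{F,f})`); **every element of `awayFrom w₁` commutes with every
  `adelicSingle w₁ u`** (`commute_adelicSingle_of_mem_awayFrom`) and **every `g ∈ U(J)(𝔸_F)` splits as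
  `g = adelicSingle w₁ (g_{w₁}) · k` with `k ∈ awayFrom w₁`** (`exists_eq_adelicSingle_mul`); on rational points
  `γ_{w₁} = σ_{w₁}(γ)` (`exists_toAdelic_eq_adelicSingle_mul`).
* § 2 (at a complex EMBEDDING `τ`): the twist `embTwist τ : ℂ →+* ℂ` (identity if Mathlib's `(mk τ).embedding = τ`,
  complex conjugation otherwise), so that `archAtEmb τ = GL_N(embTwist τ) ∘ archAt (mk τ)` uniformly
  (`coe_archAtEmb_eq_map_embTwist`), and the local un-twist `archLocalOfEmb τ : U(τ(J))(ℂ) →* U(σ_{mk τ} J)(ℂ)`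
  with `archLocalOfEmb τ ∘ archAtEmb τ = archAt (mk τ)`; for `N = 3` and a frame `T` (`σ(T)ᵀ τ(J) T = diag(1,1,-1)`)
  the section **`archSectionU21Emb τ T : U(2,1) →* U(J)(𝔸_F)`**, `u ↦ ((T u T⁻¹) un-twisted at mk τ, 1 elsewhere)`,
  with `archProjU21Emb τ T ∘ archPart ∘ archSectionU21Emb τ T = id`, the commutation with `awayFrom (mk τ)`, and
  **`γ = archSectionU21Emb τ T (T⁻¹ τ(γ) T) · k`, `k ∈ awayFrom (mk τ)`, for every rational `γ`**
  (`exists_toAdelic_eq_archSectionU21Emb_mul`).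
* § 3 (CM case `F = L⁺`, `c` = complex conjugation, typed on the tree constants `↥(adelicUnitaryGroup L H)` /
  `adelicUnitaryRat L H` of `AdelicUnitaryGroup` and on `BallRational.toBall` / `ratImage` of
  `UnitaryBallRationalImage`, frame spelling `Tᴴ H^ι T = diag(1,1,-1)`): `archSectionU21CM L ι H T hT`,
  `awayFromCM N L ι H`, `archProjU21EmbCM_archPart_archSectionU21CM` (right inverse of the projection), `commute_archSectionU21CM_of_mem_awayFromCM`, and
  **`∀ γ ∈ ratImage, ∃ k ∈ awayFromCM, archSectionU21CM γ · k ∈ adelicUnitaryRat L H`**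
  (`exists_archSectionU21CM_mul_mem_adelicUnitaryRat`).

References (provenance of the constructions; nothing enters as a hypothesis): A. Borel, H. Jacquet, *Automorphic
forms and automorphic representations*, Proc. Symp. Pure Math. 33.1 (1979), §4.1 (`G(𝔸) = G_∞ × G(𝔸_f)`,
`G_∞ = ∏_{v ∣ ∞} G(F_v)`, `g = g_∞ g_f`); V. Platonov, A. Rapinchuk, *Algebraic Groups and Number Theory* (1994),
§2.3 (unitary groups of hermitian forms, change of frame) and §5.1 (adele groups, `G_𝔸 = G_∞ × G_{𝔸_f}`).
-/

noncomputable section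

open NumberField NumberField.InfinitePlace Topology IsDedekindDomain

open scoped Matrix MatrixGroups ComplexConjugate ComplexOrder

namespace Literature.NumberTheory.Automorphic

namespace UnitaryGroup

open NumberField.mixedEmbedding Literature.Geometry.ComplexHyperbolic Literature.Geometry.ComplexHyperbolic.BallModel
open Literature.AlgebraicGeometry.ShimuraVarieties

variable (F E : Type) [Field F] [NumberField F] [Field E] [NumberField E] [Algebra F E]
  (c : E ≃ₐ[F] E) (N : ℕ) (J : Matrix (Fin N) (Fin N) E)

/-! ## 1. One complex place: the section `archSingle w₁`, the subgroup `awayFrom w₁` -/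

section Single

variable (hc : c ≠ 1) (hfix : ∀ w : InfinitePlace E, c • w = w) (w₁ : {w : InfinitePlace E // IsComplex w})

omit [NumberField F] [NumberField E] in
open Classical in
/-- **The section `U(σ_{w₁} J)(ℂ) →* U(J)(E ⊗ ℝ)` at the complex place `w₁`**: `u ↦ (u at w₁, 1 at w ≠ w₁)` through
`archPiEquiv : U(J)(E ⊗ ℝ) ≃ₜ* Π_w U(σ_w J)(ℂ)` (the factor inclusion `G(F_{v₁}) ↪ G_∞ = ∏_{v ∣ ∞} G(F_v)`).
[cite: BorelJacquet1979, §4.1] -/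
def archSingle : archLocal E N J w₁ →* arch F E c N J :=
  (archPiEquiv F E c N J hc hfix).symm.toMulEquiv.toMonoidHom.comp
    (MonoidHom.mulSingle (fun w : {w : InfinitePlace E // IsComplex w} => archLocal E N J w) w₁)

omit [NumberField F] [NumberField E] in
open Classical in
/-- `archSingle w₁ u = archPiEquiv.symm (mulSingle w₁ u)`. [folklore] -/
theorem archSingle_apply (u : archLocal E N J w₁) :
    archSingle F E c N J hc hfix w₁ u = (archPiEquiv F E c N J hc hfix).symm (Pi.mulSingle w₁ u) := rfl

omit [NumberField F] [NumberField E] in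
open Classical in
/-- **`(archSingle w₁ u)_{w₁} = u`.** [folklore] -/
@[simp] theorem archAt_archSingle_self (u : archLocal E N J w₁) :
    archAt F E c N J w₁ (hfix w₁.1) hc (archSingle F E c N J hc hfix w₁ u) = u := by
  rw [archSingle_apply, archAt_archPiEquiv_symm, Pi.mulSingle_eq_same]

omit [NumberField F] [NumberField E] in
open Classical in
/-- **`(archSingle w₁ u)_w = 1` for `w ≠ w₁`.** [folklore] -/
theorem archAt_archSingle_of_ne {w : {w : InfinitePlace E // IsComplex w}} (h : w ≠ w₁) (u : archLocal E N J w₁) :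
    archAt F E c N J w (hfix w.1) hc (archSingle F E c N J hc hfix w₁ u) = 1 := by
  rw [archSingle_apply, archAt_archPiEquiv_symm, Pi.mulSingle_eq_of_ne h]

omit [NumberField F] [NumberField E] in
open Classical in
/-- `archSingle w₁` is continuous. [folklore] -/
theorem continuous_archSingle : Continuous (archSingle F E c N J hc hfix w₁) :=
  (archPiEquiv F E c N J hc hfix).symm.continuous.comp
    (_root_.continuous_mulSingle (A := fun w : {w : InfinitePlace E // IsComplex w} => ↥(archLocal E N J w)) w₁)

omit [NumberField F] [NumberField E] in
/-- `archSingle w₁` is injective (it has the retraction `archAt w₁`). [folklore] -/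
theorem archSingle_injective : Function.Injective (archSingle F E c N J hc hfix w₁) :=
  Function.LeftInverse.injective (g := archAt F E c N J w₁ (hfix w₁.1) hc)
    (archAt_archSingle_self F E c N J hc hfix w₁)

/-- **The section `U(σ_{w₁} J)(ℂ) →* U(J)(𝔸_F)` at the complex place `w₁`**: `u ↦ ((u at w₁, 1 elsewhere), 1_f)`
(`archToAdelic ∘ archSingle w₁`; the factor inclusion `G(F_{v₁}) ↪ G(𝔸)`). [cite: BorelJacquet1979, §4.1] -/
def adelicSingle : archLocal E N J w₁ →* (adelicGroupData F E c N J).Adelic :=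
  (archToAdelic F E c N J).comp (archSingle F E c N J hc hfix w₁)

/-- `adelicSingle w₁ u = archToAdelic (archSingle w₁ u)` (definitional). [folklore] -/
theorem adelicSingle_apply (u : archLocal E N J w₁) :
    adelicSingle F E c N J hc hfix w₁ u = archToAdelic F E c N J (archSingle F E c N J hc hfix w₁ u) := rfl

/-- `(adelicSingle w₁ u)_∞ = archSingle w₁ u`. [folklore] -/
@[simp] theorem archPart_adelicSingle (u : archLocal E N J w₁) :
    archPart F E c N J (adelicSingle F E c N J hc hfix w₁ u) = archSingle F E c N J hc hfix w₁ u :=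
  archPart_archToAdelic F E c N J _

/-- `(adelicSingle w₁ u)_f = 1`. [folklore] -/
@[simp] theorem finPart_adelicSingle (u : archLocal E N J w₁) :
    finPart F E c N J (adelicSingle F E c N J hc hfix w₁ u) = 1 :=
  finPart_archToAdelic F E c N J _

/-- **`(adelicSingle w₁ u)_{w₁} = u`.** [folklore] -/
@[simp] theorem archAt_archPart_adelicSingle (u : archLocal E N J w₁) :
    archAt F E c N J w₁ (hfix w₁.1) hc (archPart F E c N J (adelicSingle F E c N J hc hfix w₁ u)) = u := by
  rw [archPart_adelicSingle, archAt_archSingle_self]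

/-- `adelicSingle w₁` is continuous. [folklore] -/
theorem continuous_adelicSingle : Continuous (adelicSingle F E c N J hc hfix w₁) :=
  (continuous_archToAdelic F E c N J).comp (continuous_archSingle F E c N J hc hfix w₁)

/-- `adelicSingle w₁` is injective. [folklore] -/
theorem adelicSingle_injective : Function.Injective (adelicSingle F E c N J hc hfix w₁) :=
  Function.LeftInverse.injective
    (g := fun g => archAt F E c N J w₁ (hfix w₁.1) hc (archPart F E c N J g))
    (archAt_archPart_adelicSingle F E c N J hc hfix w₁)

/-- **The subgroup of `U(J)(𝔸_F)` away from `w₁`**: the elements with trivial `w₁`-component, i.e. the kernel of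
`g ↦ (g_∞)_{w₁}`; it is `Π_{w ≠ w₁} U(σ_w J)(ℂ) × U(J)(𝔸_{F,f})` (the product of all local factors but the one at
`w₁`). [cite: BorelJacquet1979, §4.1] -/
def awayFrom : Subgroup (adelicGroupData F E c N J).Adelic :=
  ((archAt F E c N J w₁ (hfix w₁.1) hc).comp (archPart F E c N J)).ker

/-- `k ∈ awayFrom w₁ ↔ (k_∞)_{w₁} = 1`. [folklore] -/
theorem mem_awayFrom_iff (k : (adelicGroupData F E c N J).Adelic) :
    k ∈ awayFrom F E c N J hc hfix w₁ ↔ archAt F E c N J w₁ (hfix w₁.1) hc (archPart F E c N J k) = 1 :=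
  MonoidHom.mem_ker

/-- The finite-adelic factor lies away from every infinite place: `(1, b) ∈ awayFrom w₁`. [folklore] -/
theorem finAdelicToAdelic_mem_awayFrom (b : finAdelic F E c N J) :
    finAdelicToAdelic F E c N J b ∈ awayFrom F E c N J hc hfix w₁ := by
  rw [mem_awayFrom_iff, archPart_finAdelicToAdelic, map_one]

/-- The kernel of `archPart` (the finite-adelic group, `ker_archPart`) lies in `awayFrom w₁`. [folklore] -/
theorem ker_archPart_le_awayFrom : (archPart F E c N J).ker ≤ awayFrom F E c N J hc hfix w₁ := fun k hk => by
  rw [mem_awayFrom_iff, MonoidHom.mem_ker.1 hk, map_one]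

/-- An archimedean element lies away from `w₁` iff its `w₁`-component is trivial. [folklore] -/
theorem archToAdelic_mem_awayFrom_iff (a : arch F E c N J) :
    archToAdelic F E c N J a ∈ awayFrom F E c N J hc hfix w₁ ↔ archAt F E c N J w₁ (hfix w₁.1) hc a = 1 := by
  rw [mem_awayFrom_iff, archPart_archToAdelic]

/-- The section at another place lands away from `w₁`: `adelicSingle w u ∈ awayFrom w₁` for `w ≠ w₁`. [folklore] -/
theorem adelicSingle_mem_awayFrom_of_ne {w : {w : InfinitePlace E // IsComplex w}} (h : w₁ ≠ w)
    (u : archLocal E N J w) : adelicSingle F E c N J hc hfix w u ∈ awayFrom F E c N J hc hfix w₁ := by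
  rw [adelicSingle_apply, archToAdelic_mem_awayFrom_iff, archAt_archSingle_of_ne F E c N J hc hfix w h]

omit [NumberField F] [NumberField E] in
/-- In `U(J)(E ⊗ ℝ)`: an element with trivial `w₁`-component commutes with `archSingle w₁ u` (componentwise in
`Π_w U(σ_w J)(ℂ)`: at `w₁` one factor is `1`, at `w ≠ w₁` the other is). [folklore] -/
theorem commute_archSingle_of_archAt_eq_one (u : archLocal E N J w₁) {a : arch F E c N J}
    (ha : archAt F E c N J w₁ (hfix w₁.1) hc a = 1) : Commute a (archSingle F E c N J hc hfix w₁ u) := by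
  rw [Commute, SemiconjBy]
  apply (archPiEquiv F E c N J hc hfix).injective
  rw [map_mul, map_mul]
  funext w
  rw [Pi.mul_apply, Pi.mul_apply, archPiEquiv_apply, archPiEquiv_apply]
  by_cases hw : w = w₁
  · subst hw
    rw [archAt_archSingle_self, ha, one_mul, mul_one]
  · rw [archAt_archSingle_of_ne F E c N J hc hfix w₁ hw, one_mul, mul_one]

/-- **Elements away from `w₁` commute with the `w₁`-factor**: `k ∈ awayFrom w₁ → Commute k (adelicSingle w₁ u)`
(`k = k_∞ · k_f` with `(k_∞)_{w₁} = 1`; `k_f` commutes with the archimedean factor,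
`commute_archToAdelic_finAdelicToAdelic`). [cite: BorelJacquet1979, §4.1] -/
theorem commute_adelicSingle_of_mem_awayFrom (u : archLocal E N J w₁) {k : (adelicGroupData F E c N J).Adelic}
    (hk : k ∈ awayFrom F E c N J hc hfix w₁) : Commute k (adelicSingle F E c N J hc hfix w₁ u) := by
  have harch : Commute (archToAdelic F E c N J (archPart F E c N J k)) (adelicSingle F E c N J hc hfix w₁ u) :=
    (commute_archSingle_of_archAt_eq_one F E c N J hc hfix w₁ u ((mem_awayFrom_iff F E c N J hc hfix w₁ k).1 hk)).map
      (archToAdelic F E c N J)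
  have hfin : Commute (finAdelicToAdelic F E c N J (finPart F E c N J k)) (adelicSingle F E c N J hc hfix w₁ u) :=
    (commute_archToAdelic_finAdelicToAdelic F E c N J _ _).symm
  rw [← archToAdelic_mul_finAdelicToAdelic F E c N J k]
  exact harch.mul_left hfin

/-- **Splitting off the `w₁`-component**: every `g ∈ U(J)(𝔸_F)` is `adelicSingle w₁ ((g_∞)_{w₁}) · k` with
`k ∈ awayFrom w₁`. [cite: BorelJacquet1979, §4.1] -/
theorem exists_eq_adelicSingle_mul (g : (adelicGroupData F E c N J).Adelic) :
    ∃ k ∈ awayFrom F E c N J hc hfix w₁,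
      g = adelicSingle F E c N J hc hfix w₁ (archAt F E c N J w₁ (hfix w₁.1) hc (archPart F E c N J g)) * k := by
  refine ⟨(adelicSingle F E c N J hc hfix w₁ (archAt F E c N J w₁ (hfix w₁.1) hc (archPart F E c N J g)))⁻¹ * g,
    ?_, (mul_inv_cancel_left _ _).symm⟩
  rw [mem_awayFrom_iff, map_mul, map_inv, map_mul, map_inv, archAt_archPart_adelicSingle, inv_mul_cancel]

/-- **On rational points**: `γ = adelicSingle w₁ (σ_{w₁} γ) · k` with `k ∈ awayFrom w₁` (`(γ)_∞ = γ ⊗ 1`,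
`archPart_toAdelic`; `(γ ⊗ 1)_{w₁} = σ_{w₁}(γ)`, `archAt_rationalToArch`). [cite: BorelJacquet1979, §4.1] -/
theorem exists_toAdelic_eq_adelicSingle_mul (γ : rational F E c N J) :
    ∃ k ∈ awayFrom F E c N J hc hfix w₁,
      toAdelic F E c N J γ =
        adelicSingle F E c N J hc hfix w₁ (rationalToArchLocal F E c N J w₁ (hfix w₁.1) hc γ) * k := by
  obtain ⟨k, hk, h⟩ := exists_eq_adelicSingle_mul F E c N J hc hfix w₁ (toAdelic F E c N J γ)
  refine ⟨k, hk, ?_⟩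
  rwa [archPart_toAdelic, archAt_rationalToArch] at h

end Single

/-! ## 2. At a complex embedding `τ`: the twist, the local un-twist, the `U(2,1)` section through a frame -/

section Emb

variable (hc : c ≠ 1) (hfix : ∀ w : InfinitePlace E, c • w = w) (τ : E →+* ℂ) (hτ : IsComplex (InfinitePlace.mk τ))

omit [NumberField E] in
open Classical in
/-- **The twist at `τ`**: the identity of `ℂ` if Mathlib's chosen embedding of the place `mk τ` is `τ`, complex
conjugation if it is `conj ∘ τ` (`embedding_mk_eq`). [folklore] -/
def embTwist : ℂ →+* ℂ := if (InfinitePlace.mk τ).embedding = τ then RingHom.id ℂ else starRingEnd ℂ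

omit [NumberField E] in
/-- First case: `embTwist τ = id`. [folklore] -/
theorem embTwist_apply_of_eq (h : (InfinitePlace.mk τ).embedding = τ) (z : ℂ) : embTwist E τ z = z := by
  rw [embTwist, if_pos h, RingHom.id_apply]

omit [NumberField E] in
/-- Second case: `embTwist τ = conj`. [folklore] -/
theorem embTwist_apply_of_ne (h : (InfinitePlace.mk τ).embedding ≠ τ) (z : ℂ) : embTwist E τ z = starRingEnd ℂ z := by
  rw [embTwist, if_neg h]

omit [NumberField E] in
/-- `embTwist τ` is an involution. [folklore] -/
@[simp] theorem embTwist_embTwist (z : ℂ) : embTwist E τ (embTwist E τ z) = z := by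
  by_cases h : (InfinitePlace.mk τ).embedding = τ
  · rw [embTwist_apply_of_eq E τ h, embTwist_apply_of_eq E τ h]
  · rw [embTwist_apply_of_ne E τ h, embTwist_apply_of_ne E τ h, Complex.conj_conj]

omit [NumberField E] in
/-- `embTwist τ` commutes with complex conjugation. [folklore] -/
theorem embTwist_conj (z : ℂ) : embTwist E τ (starRingEnd ℂ z) = starRingEnd ℂ (embTwist E τ z) := by
  by_cases h : (InfinitePlace.mk τ).embedding = τ
  · rw [embTwist_apply_of_eq E τ h, embTwist_apply_of_eq E τ h]
  · rw [embTwist_apply_of_ne E τ h, embTwist_apply_of_ne E τ h]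

omit [NumberField E] in
/-- **`embTwist τ ∘ τ = σ_{mk τ}`** (Mathlib's embedding of the place of `τ`). [folklore] -/
theorem embTwist_apply_apply (x : E) : embTwist E τ (τ x) = (InfinitePlace.mk τ).embedding x := by
  by_cases h : (InfinitePlace.mk τ).embedding = τ
  · rw [embTwist_apply_of_eq E τ h, h]
  · rw [embTwist_apply_of_ne E τ h, embedding_mk_eq_conjugate_of_ne E τ h, ComplexEmbedding.conjugate_coe_eq]

omit [NumberField E] in
/-- Conversely `embTwist τ ∘ σ_{mk τ} = τ`. [folklore] -/
theorem embTwist_embedding_apply (x : E) : embTwist E τ ((InfinitePlace.mk τ).embedding x) = τ x := by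
  rw [← embTwist_apply_apply E τ x, embTwist_embTwist]

omit [NumberField E] in
/-- `embTwist τ` is continuous. [folklore] -/
theorem continuous_embTwist : Continuous (embTwist E τ) := by
  by_cases h : (InfinitePlace.mk τ).embedding = τ
  · have : (embTwist E τ : ℂ → ℂ) = id := funext fun z => embTwist_apply_of_eq E τ h z
    rw [this]; exact continuous_id
  · have : (embTwist E τ : ℂ → ℂ) = starRingEnd ℂ := funext fun z => embTwist_apply_of_ne E τ h z
    rw [this]; exact Complex.continuous_conj

omit [NumberField E] in
/-- `evalEmb τ = embTwist τ ∘ evalC (mk τ)`: evaluation at the embedding is the twisted place-coordinate. [folklore] -/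
theorem evalEmb_eq_embTwist (x : mixedSpace E) : evalEmb E τ hτ x = embTwist E τ (x.2 (placeOf E τ hτ)) := by
  by_cases h : (InfinitePlace.mk τ).embedding = τ
  · rw [evalEmb_apply_of_eq E τ hτ h, embTwist_apply_of_eq E τ h]
  · rw [evalEmb_apply_of_ne E τ hτ h, embTwist_apply_of_ne E τ h]

omit [NumberField E] in
/-- `τ(J)` twisted is `σ_{mk τ}(J)`. [folklore] -/
theorem map_map_embTwist : (J.map τ).map (embTwist E τ) = J.map (placeOf E τ hτ).1.embedding := by
  rw [Matrix.map_map]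
  exact congrArg J.map (funext fun x => embTwist_apply_apply E τ x)

/-- **The local un-twist `U(τ(J))(ℂ) →* U(σ_{mk τ} J)(ℂ)`**, `u ↦ GL_N(embTwist τ) u` (the identity, or entrywise
complex conjugation, an isomorphism of the two models of the factor of `U(J)(E ⊗ ℝ)` at the place of `τ`). [folklore] -/
def archLocalOfEmb : unitaryGroupOfForm (starRingEnd ℂ) (J.map τ) →* archLocal E N J (placeOf E τ hτ) :=
  (((Matrix.GeneralLinearGroup.map (embTwist E τ)).restrict (unitaryGroupOfForm (starRingEnd ℂ) (J.map τ)))).codRestrict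
    (archLocal E N J (placeOf E τ hτ)) fun u => by
      have h := map_mem_unitaryGroupOfForm (σ := starRingEnd ℂ) (τ := starRingEnd ℂ) (embTwist E τ)
        (embTwist_conj E τ) u.2
      rw [map_map_embTwist E N J τ hτ] at h
      exact h

omit [NumberField E] in
/-- `archLocalOfEmb τ u = GL_N(embTwist τ) u` on underlying invertible matrices. [folklore] -/
@[simp] theorem coe_archLocalOfEmb (u : unitaryGroupOfForm (starRingEnd ℂ) (J.map τ)) :
    ((archLocalOfEmb E N J τ hτ u : archLocal E N J (placeOf E τ hτ)) : GL (Fin N) ℂ) =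
      Matrix.GeneralLinearGroup.map (embTwist E τ) (u : GL (Fin N) ℂ) :=
  rfl

omit [NumberField E] in
/-- `GL_N(embTwist τ)` is an involution. [folklore] -/
@[simp] theorem generalLinearGroup_map_embTwist_map_embTwist (g : GL (Fin N) ℂ) :
    Matrix.GeneralLinearGroup.map (embTwist E τ) (Matrix.GeneralLinearGroup.map (embTwist E τ) g) = g :=
  Units.ext <| Matrix.ext fun _ _ => embTwist_embTwist E τ _

omit [NumberField E] in
/-- `archLocalOfEmb τ` is continuous. [folklore] -/
theorem continuous_archLocalOfEmb : Continuous (archLocalOfEmb E N J τ hτ) :=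
  (((continuous_embTwist E τ).generalLinearGroup_map :
      Continuous (Matrix.GeneralLinearGroup.map (n := Fin N) (embTwist E τ))).comp continuous_subtype_val).subtype_mk _

omit [NumberField E] in
/-- `archLocalOfEmb τ` is injective. [folklore] -/
theorem archLocalOfEmb_injective : Function.Injective (archLocalOfEmb E N J τ hτ) := fun u v h => by
  apply Subtype.ext
  have h' := congrArg (fun x : archLocal E N J (placeOf E τ hτ) =>
    Matrix.GeneralLinearGroup.map (embTwist E τ) (x : GL (Fin N) ℂ)) h
  simpa only [coe_archLocalOfEmb, generalLinearGroup_map_embTwist_map_embTwist] using h'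

omit [NumberField F] [NumberField E] in
/-- **`archAtEmb τ = GL_N(embTwist τ) ∘ archAt (mk τ)`** on underlying matrices, uniformly in the two cases of
`coe_archAtEmb_of_eq` / `coe_archAtEmb_of_ne`. [folklore] -/
theorem coe_archAtEmb_eq_map_embTwist (g : arch F E c N J) :
    ((archAtEmb F E c N J τ hτ (hfix _) hc g : unitaryGroupOfForm (starRingEnd ℂ) (J.map τ)) : GL (Fin N) ℂ) =
      Matrix.GeneralLinearGroup.map (embTwist E τ)
        ((archAt F E c N J (placeOf E τ hτ) (hfix _) hc g : archLocal E N J (placeOf E τ hτ)) : GL (Fin N) ℂ) :=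
  Units.ext <| Matrix.ext fun i j => by
    rw [coe_archAtEmb_apply, evalEmb_eq_embTwist]
    rfl

omit [NumberField F] [NumberField E] in
/-- **`archLocalOfEmb τ (archAtEmb τ g) = archAt (mk τ) g`**: un-twisting the `τ`-component gives the
`mk τ`-component. [folklore] -/
@[simp] theorem archLocalOfEmb_archAtEmb (g : arch F E c N J) :
    archLocalOfEmb E N J τ hτ (archAtEmb F E c N J τ hτ (hfix _) hc g) =
      archAt F E c N J (placeOf E τ hτ) (hfix _) hc g :=
  Subtype.ext <| by
    rw [coe_archLocalOfEmb, coe_archAtEmb_eq_map_embTwist, generalLinearGroup_map_embTwist_map_embTwist]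

/-! ### `N = 3`: the section `U(2,1) →* U(J)(𝔸_F)` through a frame -/

variable (J₃ : Matrix (Fin 3) (Fin 3) E) (T : GL (Fin 3) ℂ) (hT : formCongr (starRingEnd ℂ) T (J₃.map τ) = BallModel.J)

omit [NumberField E] in
/-- `formEquivU21.symm u = T u T⁻¹` on underlying invertible matrices. [folklore] -/
@[simp] theorem coe_formEquivU21_symm_apply (u : U21) :
    (((formEquivU21 E J₃ τ T hT).symm u : unitaryGroupOfForm (starRingEnd ℂ) (J₃.map τ)) : GL (Fin 3) ℂ) =
      T * u * T⁻¹ := rfl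

/-- **The archimedean section at the embedding `τ` through the frame `T`: `U(2,1) →* U(J)(𝔸_F)`**,
`u ↦ adelicSingle (mk τ) (un-twist (T u T⁻¹))` — the inclusion of the factor `U(J)(F_{v₁}) ≅ U(2,1)` of
`G(𝔸) = G_∞ × G(𝔸_f)`, `G_∞ = ∏_v G(F_v)`, in the `U(2,1)`-coordinates of the frame. [cite: BorelJacquet1979, §4.1] -/
def archSectionU21Emb : U21 →* (adelicGroupData F E c 3 J₃).Adelic where
  toFun u := adelicSingle F E c 3 J₃ hc hfix (placeOf E τ hτ)
    (archLocalOfEmb E 3 J₃ τ hτ ((formEquivU21 E J₃ τ T hT).symm u))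
  map_one' := by simp only [map_one]
  map_mul' u v := by simp only [map_mul]

/-- Unfolding `archSectionU21Emb`. [folklore] -/
theorem archSectionU21Emb_apply (u : U21) :
    archSectionU21Emb F E c hc hfix τ hτ J₃ T hT u =
      adelicSingle F E c 3 J₃ hc hfix (placeOf E τ hτ)
        (archLocalOfEmb E 3 J₃ τ hτ ((formEquivU21 E J₃ τ T hT).symm u)) := rfl

/-- `archSectionU21Emb` is continuous. [folklore] -/
theorem continuous_archSectionU21Emb : Continuous (archSectionU21Emb F E c hc hfix τ hτ J₃ T hT) :=
  (continuous_adelicSingle F E c 3 J₃ hc hfix (placeOf E τ hτ)).comp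
    ((continuous_archLocalOfEmb E 3 J₃ τ hτ).comp (formEquivU21 E J₃ τ T hT).symm.continuous)

/-- `archSectionU21Emb` is injective. [folklore] -/
theorem archSectionU21Emb_injective : Function.Injective (archSectionU21Emb F E c hc hfix τ hτ J₃ T hT) :=
  (adelicSingle_injective F E c 3 J₃ hc hfix (placeOf E τ hτ)).comp
    ((archLocalOfEmb_injective E 3 J₃ τ hτ).comp (formEquivU21 E J₃ τ T hT).symm.injective)

omit [NumberField F] [NumberField E] in
/-- **The `w₁`-component of a rational point in frame coordinates**: `(γ ⊗ 1)_{mk τ}` is the un-twist of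
`T (T⁻¹ τ(γ) T) T⁻¹`, i.e. `archAt (mk τ) (γ ⊗ 1) = archLocalOfEmb τ (formEquivU21.symm (archProjU21Emb τ T (γ ⊗ 1)))`.
[folklore] -/
theorem archAt_rationalToArch_eq_archLocalOfEmb (γ : rational F E c 3 J₃) :
    archAt F E c 3 J₃ (placeOf E τ hτ) (hfix _) hc (rationalToArch F E c 3 J₃ γ) =
      archLocalOfEmb E 3 J₃ τ hτ ((formEquivU21 E J₃ τ T hT).symm
        (archProjU21Emb F E c J₃ τ hτ T hT (hfix _) hc (rationalToArch F E c 3 J₃ γ))) := by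
  have h1 : archProjU21Emb F E c J₃ τ hτ T hT (hfix _) hc (rationalToArch F E c 3 J₃ γ) =
      formEquivU21 E J₃ τ T hT (archAtEmb F E c 3 J₃ τ hτ (hfix _) hc (rationalToArch F E c 3 J₃ γ)) := rfl
  rw [h1, ContinuousMulEquiv.symm_apply_apply, archLocalOfEmb_archAtEmb]

/-- **`archProjU21Emb τ T ((archSectionU21Emb τ T u)_∞) = u`**: the section is a right inverse of the archimedean
projection at `τ` through the frame. [folklore] -/
@[simp] theorem archProjU21Emb_archPart_archSectionU21Emb (u : U21) :
    archProjU21Emb F E c J₃ τ hτ T hT (hfix _) hc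
        (archPart F E c 3 J₃ (archSectionU21Emb F E c hc hfix τ hτ J₃ T hT u)) = u := by
  rw [archSectionU21Emb_apply, archPart_adelicSingle]
  apply Subtype.ext
  rw [coe_archProjU21Emb_apply, coe_archAtEmb_eq_map_embTwist, archAt_archSingle_self, coe_archLocalOfEmb,
    generalLinearGroup_map_embTwist_map_embTwist, coe_formEquivU21_symm_apply]
  group

/-- **Elements away from `mk τ` commute with the section.** [folklore] -/
theorem commute_archSectionU21Emb_of_mem_awayFrom (u : U21) {k : (adelicGroupData F E c 3 J₃).Adelic}
    (hk : k ∈ awayFrom F E c 3 J₃ hc hfix (placeOf E τ hτ)) :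
    Commute k (archSectionU21Emb F E c hc hfix τ hτ J₃ T hT u) := by
  rw [archSectionU21Emb_apply]
  exact commute_adelicSingle_of_mem_awayFrom F E c 3 J₃ hc hfix (placeOf E τ hτ) _ hk

/-- **Splitting of rational points through the frame**: `γ = archSectionU21Emb τ T (T⁻¹ τ(γ) T) · k` with
`k ∈ awayFrom (mk τ)`, for every `γ ∈ U(J)(F)` (diagonally embedded). [cite: BorelJacquet1979, §4.1] -/
theorem exists_toAdelic_eq_archSectionU21Emb_mul (γ : rational F E c 3 J₃) :
    ∃ k ∈ awayFrom F E c 3 J₃ hc hfix (placeOf E τ hτ),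
      toAdelic F E c 3 J₃ γ =
        archSectionU21Emb F E c hc hfix τ hτ J₃ T hT
          (archProjU21Emb F E c J₃ τ hτ T hT (hfix _) hc (rationalToArch F E c 3 J₃ γ)) * k := by
  obtain ⟨k, hk, h⟩ := exists_eq_adelicSingle_mul F E c 3 J₃ hc hfix (placeOf E τ hτ) (toAdelic F E c 3 J₃ γ)
  refine ⟨k, hk, ?_⟩
  rwa [archPart_toAdelic, archAt_rationalToArch_eq_archLocalOfEmb F E c hc hfix τ hτ J₃ T hT,
    ← archSectionU21Emb_apply] at h

end Emb

/-! ## 3. The CM case, typed on `↥(adelicUnitaryGroup L H)` / `adelicUnitaryRat L H` and on `BallRational.toBall` -/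

section CM

variable (L : Type) [Field L] [NumberField L] [IsCMField L] (ι : L →+* ℂ) (H : Matrix (Fin N) (Fin N) L)

/-- The complex place of the embedding `ι` of the CM field `L`. [folklore] -/
abbrev cmPlace : {w : InfinitePlace L // IsComplex w} := placeOf L ι (isComplex_mk_of_isCMField L ι)

/-- **CM case: the subgroup of `U(H)(𝔸_{L⁺})` away from the place of `ι`**, typed on `↥(adelicUnitaryGroup L H)`
(`= (adelicGroupData L⁺ L c N H).Adelic` definitionally, `adelic_complexConj`). [cite: BorelJacquet1979, §4.1] -/
def awayFromCM : Subgroup ↥(adelicUnitaryGroup L H) :=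
  awayFrom (↥(maximalRealSubfield L)) L (IsCMField.complexConj L) N H (IsCMField.complexConj_ne_one L)
    (complexConj_smul_infinitePlace L) (cmPlace L ι)

variable (H : Matrix (Fin 3) (Fin 3) L) (T : GL (Fin 3) ℂ)

omit [NumberField L] [IsCMField L] in
/-- The frame identity in the `formCongr` spelling: `σ(T)ᵀ H^ι T = Tᴴ H^ι T`. [folklore] -/
theorem formCongr_eq_of_conjTranspose
    (hT : (T : Matrix (Fin 3) (Fin 3) ℂ)ᴴ * H.map ι * (T : Matrix (Fin 3) (Fin 3) ℂ) = BallModel.J) :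
    formCongr (starRingEnd ℂ) T (H.map ι) = BallModel.J := by
  rw [← hT]
  rfl

/-- **CM case: the archimedean section `U(2,1) →* U(H)(𝔸_{L⁺})` at the embedding `ι` through a frame `T`
(`Tᴴ H^ι T = diag(1,1,-1)`)**, typed on `↥(adelicUnitaryGroup L H)`. [cite: BorelJacquet1979, §4.1] -/
def archSectionU21CM (hT : (T : Matrix (Fin 3) (Fin 3) ℂ)ᴴ * H.map ι * (T : Matrix (Fin 3) (Fin 3) ℂ) = BallModel.J) :
    U21 →* ↥(adelicUnitaryGroup L H) :=
  archSectionU21Emb (↥(maximalRealSubfield L)) L (IsCMField.complexConj L) (IsCMField.complexConj_ne_one L)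
    (complexConj_smul_infinitePlace L) ι (isComplex_mk_of_isCMField L ι) H T (formCongr_eq_of_conjTranspose L ι H T hT)

variable (hT : (T : Matrix (Fin 3) (Fin 3) ℂ)ᴴ * H.map ι * (T : Matrix (Fin 3) (Fin 3) ℂ) = BallModel.J)

/-- `archSectionU21CM` is continuous. [folklore] -/
theorem continuous_archSectionU21CM : Continuous (archSectionU21CM L ι H T hT) :=
  continuous_archSectionU21Emb (↥(maximalRealSubfield L)) L (IsCMField.complexConj L)
    (IsCMField.complexConj_ne_one L) (complexConj_smul_infinitePlace L) ι (isComplex_mk_of_isCMField L ι) H T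
    (formCongr_eq_of_conjTranspose L ι H T hT)

/-- `archSectionU21CM` is injective. [folklore] -/
theorem archSectionU21CM_injective : Function.Injective (archSectionU21CM L ι H T hT) :=
  archSectionU21Emb_injective (↥(maximalRealSubfield L)) L (IsCMField.complexConj L)
    (IsCMField.complexConj_ne_one L) (complexConj_smul_infinitePlace L) ι (isComplex_mk_of_isCMField L ι) H T
    (formCongr_eq_of_conjTranspose L ι H T hT)

/-- **CM case: `k ∈ awayFromCM → Commute k (archSectionU21CM u)`.** [folklore] -/
theorem commute_archSectionU21CM_of_mem_awayFromCM (u : U21) {k : ↥(adelicUnitaryGroup L H)}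
    (hk : k ∈ awayFromCM 3 L ι H) : Commute k (archSectionU21CM L ι H T hT u) :=
  commute_archSectionU21Emb_of_mem_awayFrom (↥(maximalRealSubfield L)) L (IsCMField.complexConj L)
    (IsCMField.complexConj_ne_one L) (complexConj_smul_infinitePlace L) ι (isComplex_mk_of_isCMField L ι) H T
    (formCongr_eq_of_conjTranspose L ι H T hT) u hk

/-- `archProjU21EmbCM ι T ((archSectionU21CM u)_∞) = u`: the CM section is a right inverse of the archimedean
projection at `ι` through the frame. [folklore] -/
theorem archProjU21EmbCM_archPart_archSectionU21CM (u : U21) :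
    archProjU21EmbCM L H ι T (formCongr_eq_of_conjTranspose L ι H T hT)
        (archPart (↥(maximalRealSubfield L)) L (IsCMField.complexConj L) 3 H (archSectionU21CM L ι H T hT u)) = u :=
  archProjU21Emb_archPart_archSectionU21Emb (↥(maximalRealSubfield L)) L (IsCMField.complexConj L)
    (IsCMField.complexConj_ne_one L) (complexConj_smul_infinitePlace L) ι (isComplex_mk_of_isCMField L ι) H T
    (formCongr_eq_of_conjTranspose L ι H T hT) u

/-- A point of `U(H)(L⁺)` in the `IsCMField.complexConj` spelling of `UnitaryBallRationalImage` as a point of the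
generic `rational L⁺ L c 3 H` (same subgroup of `GL₃(L)`, `rational_complexConj`). [folklore] -/
def ballRational (g : unitaryGroup (IsCMField.complexConj L : L →+* L) H) :
    rational (↥(maximalRealSubfield L)) L (IsCMField.complexConj L) 3 H :=
  ⟨g, g.2⟩

/-- `ballRational g = g` on matrices. [folklore] -/
@[simp] theorem coe_ballRational (g : unitaryGroup (IsCMField.complexConj L : L →+* L) H) :
    ((ballRational L H g : rational (↥(maximalRealSubfield L)) L (IsCMField.complexConj L) 3 H) : GL (Fin 3) L) = g :=
  rfl

/-- The diagonal image of a rational point lies in `adelicUnitaryRat L H`. [folklore] -/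
theorem toAdelic_ballRational_mem_adelicUnitaryRat (g : unitaryGroup (IsCMField.complexConj L : L →+* L) H) :
    (toAdelic (↥(maximalRealSubfield L)) L (IsCMField.complexConj L) 3 H (ballRational L H g) :
        ↥(adelicUnitaryGroup L H)) ∈ adelicUnitaryRat L H :=
  (mem_adelicUnitaryRat_iff L H _).2 ⟨g, g.2, rfl⟩

/-- **`toBall ι T g = archProjU21EmbCM ι T (g ⊗ 1)`**: the frame map of `UnitaryBallRationalImage` is the
archimedean projection of the automorphic lane on rational points (both are `T⁻¹ g^ι T`). [folklore] -/
theorem toBall_eq_archProjU21EmbCM (g : unitaryGroup (IsCMField.complexConj L : L →+* L) H) :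
    BallRational.toBall L ι H T hT g =
      archProjU21EmbCM L H ι T (formCongr_eq_of_conjTranspose L ι H T hT)
        (rationalToArch (↥(maximalRealSubfield L)) L (IsCMField.complexConj L) 3 H (ballRational L H g)) := by
  apply Subtype.ext
  apply Units.ext
  rw [coe_archProjU21EmbCM_rationalToArch]
  change mat (BallRational.toBall L ι H T hT g) = _
  rw [BallRational.mat_toBall]
  rfl

/-- **CM case, splitting of rational points: `∀ γ ∈ Δ, ∃ k ∈ awayFromCM, archSectionU21CM γ · k ∈ U(H)(L⁺)`**
for the image `Δ = ratImage` of `U(H)(L⁺)` in `U(2,1)` along the frame — the `w₁`-component of `γ ⊗ 1` in frame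
coordinates is `γ` itself and the remaining components are absorbed in `k`. [cite: BorelJacquet1979, §4.1] -/
theorem exists_archSectionU21CM_mul_mem_adelicUnitaryRat {γ : U21} (hγ : γ ∈ BallRational.ratImage L ι H T hT) :
    ∃ k ∈ awayFromCM 3 L ι H, archSectionU21CM L ι H T hT γ * k ∈ adelicUnitaryRat L H := by
  obtain ⟨g, rfl⟩ := hγ
  obtain ⟨k, hk, h⟩ := exists_toAdelic_eq_archSectionU21Emb_mul (↥(maximalRealSubfield L)) L
    (IsCMField.complexConj L) (IsCMField.complexConj_ne_one L) (complexConj_smul_infinitePlace L) ι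
    (isComplex_mk_of_isCMField L ι) H T (formCongr_eq_of_conjTranspose L ι H T hT) (ballRational L H g)
  refine ⟨k, hk, ?_⟩
  have h' : archSectionU21Emb (↥(maximalRealSubfield L)) L (IsCMField.complexConj L) (IsCMField.complexConj_ne_one L)
        (complexConj_smul_infinitePlace L) ι (isComplex_mk_of_isCMField L ι) H T
        (formCongr_eq_of_conjTranspose L ι H T hT) (BallRational.toBall L ι H T hT g) * k =
      toAdelic (↥(maximalRealSubfield L)) L (IsCMField.complexConj L) 3 H (ballRational L H g) :=
    (congrArg (fun u => archSectionU21Emb (↥(maximalRealSubfield L)) L (IsCMField.complexConj L)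
        (IsCMField.complexConj_ne_one L) (complexConj_smul_infinitePlace L) ι (isComplex_mk_of_isCMField L ι) H T
        (formCongr_eq_of_conjTranspose L ι H T hT) u * k) (toBall_eq_archProjU21EmbCM L ι H T hT g)).trans h.symm
  refine (mem_adelicUnitaryRat_iff L H _).2 ⟨g, g.2, ?_⟩
  exact congrArg Subtype.val h'.symm

end CM

end UnitaryGroup

end Literature.NumberTheory.Automorphic
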